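import Literature.MathematicalPhysics.QuantumFieldTheory.Balaban1983to89.B12Decay510
import Literature.MathematicalPhysics.QuantumFieldTheory.Balaban1983to89.Beta.RemainderLocality

/-!
# `Balaban1983to89.B12Eq435SecondVariation` — [Balaban1987RG1] (4.6) p. 282 at n = 2 with (4.14) p. 284: the second variation of a
# LOCALLY REPRESENTED functional `𝓔(B) = Σ_X 𝐄(X, χ_X(ι B))` at `B = 0` IS the sum of the second derivatives of the charted pieces on the
# RESPONSES `Dι(0)·` — print's (4.35) «𝐄^{(2)}(X) = ⟨(δ²∕δ𝐇²)𝐄(X, 1) H_j(□₀), H_j(□₀)⟩» and (4.37) «Π = Σ_X 𝐄^{(2)}(X)» as one kernel identity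

CITATION HEADER (lean-in-tree rule 2026-08-18).  Source: T. Bałaban, *Renormalization group approach to lattice gauge field theories. I*, Commun. Math.
Phys. **109** (1987) 249–301 [Balaban1987RG1] (held `paper:balaban1987-cmp109-rg-i-small-field`; journal page = PDF page + 248).  Cell `ym-nodeO-ideate` ∕
`ym-balaban-port`, porter seat `ymgap-nodeO-port-PTC-1` (gen 2, helper mode; PT-H slot-8 closer-designate).

WHAT PRINT SAYS (verbatim).  p. 282 (4.6): *«(δⁿ∕δBⁿ)𝐄(U(B))|_{B=0} = Σ … ⟨(δ^r∕δ𝐇^r)𝐄(1), δ^{n₁}𝐇(0), …⟩»* (the chain rule for `B ↦ 𝐄(X, U_k(exp iB))` through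
the minimiser `𝐇(B)`); p. 284 (4.14): *«Thus we have the first, very important consequence of the gauge invariance (δ∕δB)𝐄(1) = 0. (4.14) This equality
simplifies the identities, and also the sum (4.6), we can drop the term with n = 1.»*; p. 290 (4.35): *«For n = 2, and by the identity (4.14), the formula (4.3)
yields 𝐄^{(2)}(X) = ⟨(δ²∕δ𝐇²)𝐄(X, 1) H_j(□₀), H_j(□₀)⟩ (4.35)»*, (4.37) p. 291: *«Π_{μ,ν}(x, y) = Σ_{X∈𝐃_k} 𝐄^{(2)}_{μ,ν}(X, x, y)»*.

WHAT IS TYPED (generic; the data are the binders of `B12FormatPlus.Repr17 ∕ Ward414` at ONE member of the family, with the pieces already composed with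
their charts, `F_X := 𝐄_X ∘ χ_X : V → ℂ` on a complex normed chart space `V`, and the field variable `B` in a real normed space `W`):
* §1 calculus: `fderiv_fderiv_clm_apply` (a continuous linear map passes through the second derivative), ★ `fderiv_fderiv_comp_of_contDiffAt` (the second-order
  chain rule `D²(F∘ι)(x)[p][q] = D²F(ιx)[Dι p][Dι q] + DF(ιx)[D²ι(x)[p][q]]`), `fderiv_real_fderiv_real_apply_eq_mixedDeriv` (for `F` ℂ-analytic at `0`: the REAL
  second derivative on `(a, b)` is `B12Decay510.mixedDeriv F b a`).
* §2 ★★ `fderiv_fderiv_eq_sum_mixedDeriv_of_repr` — THE BRIDGE: `Φ =ᶠ[𝓝 0] (B ↦ Σ_X F_X(ι B))`, every `F_X` analytic at `0 = ι 0`, (4.14) `DF_X(0) = 0`, `ι` of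
  class `C²` at `0` ⟹ `D²Φ(0)[p][q] = Σ_X ∂²F_X[Dι(0) q, Dι(0) p]` (= `Σ_X ∂²F_X[Dι(0) p, Dι(0) q]` by symmetry, `…_symm`); ★ `ofReal_fderiv_fderiv_eq_sum_mixedDeriv_of_repr`
  — the same for a REAL functional `Ψ` represented through `(Ψ · : ℂ)` (the shape of the record's `ΦfOf = (expChart … : ℂ)` and of `polTensor ℝ`), whose
  right-hand side is therefore real.
CONSUMERS: the generic Π-texts of the port (`PortPiHoloUniformH` ∕ `PortPiDecayUniformH`: rows `Repr17` (RowA ∕ `FormatPlusG`), `Ward414` via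
`ward414_of_gaugeInv119_chart44D`, RowL `G_k = Dι(0)·`, RowS) — with it their `pvolOf … 0 1 z` IS the kernel sum `Σ_X Re ∂²(𝐄_X∘χ_X)[h_X(·), h_X(·)]` that
`B12Decay510Gauge.decay510_of_gauge_leaves` ∕ `B12PolarizationHolo` consume.

HONEST FRAMING.  [folklore] second-order calculus + the printed (4.6)∕(4.14)∕(4.35) bookkeeping as ONE identity under NAMED hypotheses (representation, Ward row,
analyticity, `C²` embedding) — asserted for nothing; nothing of Bałaban's estimates is discharged; one finite four-torus programme at fixed ε — NOT ℝ⁴, NOT OS, NOT a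
mass gap, NOT the Clay problem.  No `def`, `instance`, `notation`, `sorry`; axioms `{propext, Classical.choice, Quot.sound}`.
-/

noncomputable section

open Metric Filter Topology Set

namespace Literature.MathematicalPhysics.QuantumFieldTheory.Balaban1983to89.B12Eq435SecondVariation

open Literature.MathematicalPhysics.QuantumFieldTheory.Balaban1983to89
open Literature.MathematicalPhysics.QuantumFieldTheory.Balaban1983to89.B12Decay510 (mixedDeriv)
open Literature.MathematicalPhysics.QuantumFieldTheory.Balaban1983to89.Beta.RemainderLocality
  (mixedDeriv_eq_fderiv_fderiv differentiableAt_fderiv_of_analyticAt)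

/-! ## §1  Second-order calculus at a point -/

section Calculus

variable {W : Type*} [NormedAddCommGroup W] [NormedSpace ℝ W] {V : Type*} [NormedAddCommGroup V] [NormedSpace ℝ V]
  {G : Type*} [NormedAddCommGroup G] [NormedSpace ℝ G] {H : Type*} [NormedAddCommGroup H] [NormedSpace ℝ H]

/-- A continuous linear map passes through the second derivative at a point: `D²(L ∘ f)(x)[p][q] = L(D²f(x)[p][q])` for `f` of class `C²` at `x` (the linear case of
the chain rule (4.6) p.282). [cite: Balaban1987RG1, (4.6) p.282] -/
theorem fderiv_fderiv_clm_apply (L : G →L[ℝ] H) {f : W → G} {x : W} (hf : ContDiffAt ℝ 2 f x) (p q : W) :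
    fderiv ℝ (fderiv ℝ (fun y => L (f y))) x p q = L (fderiv ℝ (fderiv ℝ f) x p q) := by
  -- near `x`, `f` is differentiable, so `D(L ∘ f) = L ∘L Df`
  have hev : ∀ᶠ y in 𝓝 x, DifferentiableAt ℝ f y :=
    (hf.eventually (by simp)).mono fun y hy => hy.differentiableAt two_ne_zero
  have hD : fderiv ℝ (fun y => L (f y)) =ᶠ[𝓝 x] fun y => (L : G →L[ℝ] H).comp (fderiv ℝ f y) := by
    filter_upwards [hev] with y hy
    rw [show (fun y => L (f y)) = L ∘ f from rfl, fderiv_comp y L.differentiableAt hy, L.fderiv]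
  rw [hD.fderiv_eq]
  -- differentiate `y ↦ L ∘L Df(y)` at `x`
  have hDf : DifferentiableAt ℝ (fderiv ℝ f) x := (hf.fderiv_right (m := 1) le_rfl).differentiableAt one_ne_zero
  have h2 : HasFDerivAt (fun y => (L : G →L[ℝ] H).comp (fderiv ℝ f y))
      ((ContinuousLinearMap.compL ℝ W G H L).comp (fderiv ℝ (fderiv ℝ f) x)) x :=
    (ContinuousLinearMap.compL ℝ W G H L).hasFDerivAt.comp x hDf.hasFDerivAt
  rw [h2.fderiv]
  rfl

/-- ★ **The second-order chain rule at a point**: for `ι : W → V` of class `C²` at `x` and `F : V → G` of class `C²` at `ι x`,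
`D²(F ∘ ι)(x)[p][q] = D²F(ι x)[Dι(x) p][Dι(x) q] + DF(ι x)[D²ι(x)[p][q]]` — (4.6) p.282 at `n = 2` («Σ_{r} ⟨(δ^r∕δ𝐇^r)𝐄, δ^{n₁}𝐇, …⟩»). [cite: Balaban1987RG1, (4.6) p.282] -/
theorem fderiv_fderiv_comp_of_contDiffAt {F : V → G} {ι : W → V} {x : W} (hF : ContDiffAt ℝ 2 F (ι x)) (hι : ContDiffAt ℝ 2 ι x) (p q : W) :
    fderiv ℝ (fderiv ℝ (F ∘ ι)) x p q =
      fderiv ℝ (fderiv ℝ F) (ι x) (fderiv ℝ ι x p) (fderiv ℝ ι x q) + fderiv ℝ F (ι x) (fderiv ℝ (fderiv ℝ ι) x p q) := by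
  -- near `x`: `D(F ∘ ι)(y) = DF(ι y) ∘L Dι(y)`
  have hιd : ∀ᶠ y in 𝓝 x, DifferentiableAt ℝ ι y :=
    (hι.eventually (by simp)).mono fun y hy => hy.differentiableAt two_ne_zero
  have hFd : ∀ᶠ y in 𝓝 x, DifferentiableAt ℝ F (ι y) := by
    have h1 : ∀ᶠ v in 𝓝 (ι x), DifferentiableAt ℝ F v := (hF.eventually (by simp)).mono fun v hv => hv.differentiableAt two_ne_zero
    exact (hι.continuousAt).eventually h1
  have hD : fderiv ℝ (F ∘ ι) =ᶠ[𝓝 x] fun y => (fderiv ℝ F (ι y)).comp (fderiv ℝ ι y) := by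
    filter_upwards [hιd, hFd] with y hy hFy
    exact fderiv_comp y hFy hy
  rw [hD.fderiv_eq]
  -- differentiate the composition of the two operator-valued maps (bilinear `comp`)
  have hc : HasFDerivAt (fun y => fderiv ℝ F (ι y)) ((fderiv ℝ (fderiv ℝ F) (ι x)).comp (fderiv ℝ ι x)) x := by
    have h1 : DifferentiableAt ℝ (fderiv ℝ F) (ι x) := (hF.fderiv_right (m := 1) le_rfl).differentiableAt one_ne_zero
    exact h1.hasFDerivAt.comp x (hι.differentiableAt two_ne_zero).hasFDerivAt
  have hd : HasFDerivAt (fun y => fderiv ℝ ι y) (fderiv ℝ (fderiv ℝ ι) x) x :=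
    ((hι.fderiv_right (m := 1) le_rfl).differentiableAt one_ne_zero).hasFDerivAt
  rw [(hc.clm_comp hd).fderiv]
  simp only [add_apply, ContinuousLinearMap.comp_apply, ContinuousLinearMap.compL_apply,
    ContinuousLinearMap.flip_apply]
  rw [add_comm]

variable {Vc : Type*} [NormedAddCommGroup Vc] [NormedSpace ℂ Vc]

/-- For `F : Vc → ℂ` analytic at `v`, the REAL second derivative is the complex one: `D²_ℝF(v)[a][b] = D²_ℂF(v)[a][b]`. [folklore] -/
private theorem fderiv_real_fderiv_real_apply {F : Vc → ℂ} {v : Vc} (hF : AnalyticAt ℂ F v) (a b : Vc) :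
    fderiv ℝ (fderiv ℝ F) v a b = fderiv ℂ (fderiv ℂ F) v a b := by
  -- near `v`, `D_ℝ F = restrictScalars ∘ D_ℂ F`
  have hev : ∀ᶠ w in 𝓝 v, DifferentiableAt ℂ F w := hF.eventually_analyticAt.mono fun w hw => hw.differentiableAt
  have hD : fderiv ℝ F =ᶠ[𝓝 v] fun w => (fderiv ℂ F w).restrictScalars ℝ := by
    filter_upwards [hev] with w hw using hw.fderiv_restrictScalars ℝ
  rw [hD.fderiv_eq]
  have hDf : DifferentiableAt ℂ (fderiv ℂ F) v := hF.fderiv.differentiableAt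
  -- `restrictScalars` is a continuous (ℝ-)linear map of the operator spaces
  have h2 : HasFDerivAt (fun w => (fderiv ℂ F w).restrictScalars ℝ)
      ((ContinuousLinearMap.restrictScalarsL ℂ Vc ℂ ℝ ℝ).comp ((fderiv ℂ (fderiv ℂ F) v).restrictScalars ℝ)) v :=
    (ContinuousLinearMap.restrictScalarsL ℂ Vc ℂ ℝ ℝ).hasFDerivAt.comp v (hDf.hasFDerivAt.restrictScalars ℝ)
  rw [h2.fderiv]
  rfl

/-- For `F` analytic at `0`, the real second derivative on `(a, b)` is the (4.3) mixed derivative `∂²∕∂τ₁∂τ₂ F(τ₁b + τ₂a)|₀ = B12Decay510.mixedDeriv F b a`. [cite: Balaban1987RG1, (4.3) p.281] -/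
theorem fderiv_real_fderiv_real_apply_eq_mixedDeriv {F : Vc → ℂ} (hF : AnalyticAt ℂ F 0) (a b : Vc) :
    fderiv ℝ (fderiv ℝ F) 0 a b = mixedDeriv F b a := by
  rw [fderiv_real_fderiv_real_apply hF, mixedDeriv_eq_fderiv_fderiv (differentiableAt_fderiv_of_analyticAt hF)]

/-- The (4.3) mixed derivative of a function analytic at `0` is symmetric (print's «symmetric» for the kernel it defines, (5.8) p.293). [cite: Balaban1987RG1, (4.3) p.281 with (5.8) p.293] -/
theorem mixedDeriv_symm {F : Vc → ℂ} (hF : AnalyticAt ℂ F 0) (a b : Vc) : mixedDeriv F a b = mixedDeriv F b a := by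
  rw [mixedDeriv_eq_fderiv_fderiv (differentiableAt_fderiv_of_analyticAt hF),
    mixedDeriv_eq_fderiv_fderiv (differentiableAt_fderiv_of_analyticAt hF)]
  exact (ContDiffAt.isSymmSndFDerivAt_of_omega hF.contDiffAt) b a

end Calculus

/-! ## §2  ★★ The bridge: the second variation of a locally represented functional -/

section Bridge

variable {W : Type*} [NormedAddCommGroup W] [NormedSpace ℝ W] {Vc : Type*} [NormedAddCommGroup Vc] [NormedSpace ℂ Vc]
  {Dom : Type*} [Fintype Dom]

/-- ★★ **(4.6) AT n = 2 WITH (4.14): THE SECOND VARIATION OF A LOCALLY REPRESENTED FUNCTIONAL IS THE SUM OF THE SECOND DERIVATIVES OF THE CHARTED PIECES ON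
THE RESPONSES** — (4.35)∕(4.37) as one identity.  Hypotheses (named rows of the port texts): the representation `Φ(B) = Σ_X F_X(ι B)` for `B` near `0`
(`B12FormatPlus.Repr17` at one member, `F_X = 𝐄_X ∘ χ_X`), every charted piece analytic at the chart origin `0 = ι 0` (`Chart44D` + (1.9)), the Ward row
`DF_X(0) = 0` ((4.14), `B12FormatPlus.Ward414`), the coordinate embedding `ι` of class `C²` at `0` ([15] Prop. 9).  THEN for all directions `p, q`:
`D²Φ(0)[p][q] = Σ_X ∂²F_X[Dι(0) q, Dι(0) p]` — the `n = 1` term of (4.6) drops by (4.14). [cite: Balaban1987RG1, (4.6) p.282, (4.14) p.284, (4.35) p.290, (4.37) p.291] -/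
theorem fderiv_fderiv_eq_sum_mixedDeriv_of_repr (F : Dom → Vc → ℂ) (ι : W → Vc) (Φ : W → ℂ)
    (hrepr : Φ =ᶠ[𝓝 0] fun B => ∑ X, F X (ι B)) (hι0 : ι 0 = 0) (hι : ContDiffAt ℝ 2 ι 0)
    (hF : ∀ X, AnalyticAt ℂ (F X) 0) (hW : ∀ X, fderiv ℂ (F X) 0 = 0) (p q : W) :
    fderiv ℝ (fderiv ℝ Φ) 0 p q = ∑ X, mixedDeriv (F X) (fderiv ℝ ι 0 q) (fderiv ℝ ι 0 p) := by
  -- replace `Φ` by its representation (second derivatives of eventually equal functions agree)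
  have h1 : fderiv ℝ (fderiv ℝ Φ) 0 = fderiv ℝ (fderiv ℝ fun B => ∑ X, F X (ι B)) 0 := hrepr.fderiv.fderiv_eq
  rw [h1]
  -- each summand is `C²` at `0`
  have hFr : ∀ X, ContDiffAt ℝ 2 (F X) (ι 0) := fun X => by
    rw [hι0]; exact ((hF X).contDiffAt.restrict_scalars ℝ).of_le le_top
  have hsum : ∀ X, ContDiffAt ℝ 2 (F X ∘ ι) 0 := fun X => (hFr X).comp 0 hι
  -- the second derivative of the finite sum is the sum of the second derivatives
  have hS : fderiv ℝ (fderiv ℝ fun B => ∑ X, F X (ι B)) 0 p q = ∑ X, fderiv ℝ (fderiv ℝ (F X ∘ ι)) 0 p q := by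
    have hd1 : ∀ᶠ B in 𝓝 (0 : W), ∀ X, DifferentiableAt ℝ (F X ∘ ι) B := by
      have : ∀ X, ∀ᶠ B in 𝓝 (0 : W), DifferentiableAt ℝ (F X ∘ ι) B := fun X =>
        ((hsum X).eventually (by simp)).mono fun B hB => hB.differentiableAt two_ne_zero
      exact Filter.eventually_all.2 this
    have hD : fderiv ℝ (fun B => ∑ X, F X (ι B)) =ᶠ[𝓝 0] fun B => ∑ X, fderiv ℝ (F X ∘ ι) B := by
      filter_upwards [hd1] with B hB
      have : (fun B => ∑ X, F X (ι B)) = fun B => ∑ X, (F X ∘ ι) B := rfl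
      rw [this, fderiv_fun_sum fun X _ => hB X]
    rw [hD.fderiv_eq]
    have hd2 : ∀ X, DifferentiableAt ℝ (fderiv ℝ (F X ∘ ι)) 0 := fun X =>
      ((hsum X).fderiv_right (m := 1) le_rfl).differentiableAt one_ne_zero
    rw [fderiv_fun_sum fun X _ => hd2 X]
    rw [_root_.sum_apply, _root_.sum_apply]
  rw [hS]
  refine Finset.sum_congr rfl fun X _ => ?_
  -- the second-order chain rule; the `n = 1` term vanishes by the Ward row
  rw [fderiv_fderiv_comp_of_contDiffAt (hFr X) hι, hι0]
  have hW' : fderiv ℝ (F X) 0 = 0 := by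
    rw [((hF X).differentiableAt).fderiv_restrictScalars ℝ, hW X]; rfl
  rw [hW', zero_apply, add_zero, fderiv_real_fderiv_real_apply_eq_mixedDeriv (hF X)]

/-- The same identity with the responses in the other order (`∂²F_X` is symmetric for analytic `F_X`): `D²Φ(0)[p][q] = Σ_X ∂²F_X[Dι(0) p, Dι(0) q]`.
[cite: Balaban1987RG1, (4.35) p.290, (4.37) p.291] -/
theorem fderiv_fderiv_eq_sum_mixedDeriv_of_repr_symm (F : Dom → Vc → ℂ) (ι : W → Vc) (Φ : W → ℂ)
    (hrepr : Φ =ᶠ[𝓝 0] fun B => ∑ X, F X (ι B)) (hι0 : ι 0 = 0) (hι : ContDiffAt ℝ 2 ι 0)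
    (hF : ∀ X, AnalyticAt ℂ (F X) 0) (hW : ∀ X, fderiv ℂ (F X) 0 = 0) (p q : W) :
    fderiv ℝ (fderiv ℝ Φ) 0 p q = ∑ X, mixedDeriv (F X) (fderiv ℝ ι 0 p) (fderiv ℝ ι 0 q) := by
  rw [fderiv_fderiv_eq_sum_mixedDeriv_of_repr F ι Φ hrepr hι0 hι hF hW p q]
  exact Finset.sum_congr rfl fun X _ => mixedDeriv_symm (hF X) _ _

/-- ★ **The bridge for a REAL functional represented through `ℂ`** (the shape of the record's `ΦfOf = (expChart … : ℂ)` and of `B12PolarizationTensor120.polTensor ℝ`):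
if `(Ψ · : ℂ) = Σ_X F_X(ι ·)` near `0` under the same rows, then `Ψ` is `C²` at `0` and `(D²Ψ(0)[p][q] : ℂ) = Σ_X ∂²F_X[Dι(0) q, Dι(0) p]` — in particular the
kernel sum is REAL. [cite: Balaban1987RG1, (1.20) p.264, (4.35) p.290, (4.37) p.291] -/
theorem ofReal_fderiv_fderiv_eq_sum_mixedDeriv_of_repr (F : Dom → Vc → ℂ) (ι : W → Vc) (Ψ : W → ℝ)
    (hrepr : (fun B => ((Ψ B : ℝ) : ℂ)) =ᶠ[𝓝 0] fun B => ∑ X, F X (ι B)) (hι0 : ι 0 = 0) (hι : ContDiffAt ℝ 2 ι 0)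
    (hF : ∀ X, AnalyticAt ℂ (F X) 0) (hW : ∀ X, fderiv ℂ (F X) 0 = 0) (p q : W) :
    ContDiffAt ℝ 2 Ψ 0 ∧ ((fderiv ℝ (fderiv ℝ Ψ) 0 p q : ℝ) : ℂ) = ∑ X, mixedDeriv (F X) (fderiv ℝ ι 0 q) (fderiv ℝ ι 0 p) := by
  -- the complexified functional is `C²` at `0` (it is the represented sum near `0`)
  have hFr : ∀ X, ContDiffAt ℝ 2 (F X) (ι 0) := fun X => by
    rw [hι0]; exact ((hF X).contDiffAt.restrict_scalars ℝ).of_le le_top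
  have hG : ContDiffAt ℝ 2 (fun B => ∑ X, F X (ι B)) 0 := ContDiffAt.sum fun X _ => (hFr X).comp 0 hι
  have hΦ : ContDiffAt ℝ 2 (fun B => ((Ψ B : ℝ) : ℂ)) 0 := hG.congr_of_eventuallyEq hrepr
  -- hence `Ψ = re ∘ (Ψ : ℂ)` is `C²`
  have hΨ : ContDiffAt ℝ 2 Ψ 0 := by
    have : Ψ = fun B => Complex.reCLM ((Ψ B : ℝ) : ℂ) := by funext B; simp
    rw [this]
    exact Complex.reCLM.contDiff.contDiffAt.comp 0 hΦ
  refine ⟨hΨ, ?_⟩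
  -- `D²(ofReal ∘ Ψ)(0)[p][q] = ofReal (D²Ψ(0)[p][q])` and the left side is the represented sum
  have h1 : fderiv ℝ (fderiv ℝ fun B => ((Ψ B : ℝ) : ℂ)) 0 p q = Complex.ofRealCLM (fderiv ℝ (fderiv ℝ Ψ) 0 p q) :=
    fderiv_fderiv_clm_apply Complex.ofRealCLM hΨ p q
  rw [Complex.ofRealCLM_apply] at h1
  rw [← h1]
  exact fderiv_fderiv_eq_sum_mixedDeriv_of_repr F ι _ hrepr hι0 hι hF hW p q

end Bridge

end Literature.MathematicalPhysics.QuantumFieldTheory.Balaban1983to89.B12Eq435SecondVariation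

end
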